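import Literature.Computability.Complexity.OracleQueryMap
import Literature.Computability.Complexity.CSPToCMMSAReductionProofs
import HarnessLib

/-!
# Reading the oracle's answers through a polynomial-time map (`OracleAlg.mapAnswers`)

Trunk `Complexity`, companion of `OracleQueryMap.lean` (rewriting the *queries* of an oracle
algorithm: `mapQuery`, `comap`, `clock`, `capQ`) and of `TrimAnswers.lean` (reading only the first
symbol of each answer, a finite-state transducer). Here the *answers* are rewritten by an
arbitrary non-lengthening polynomial-time string map `f`: `(M.mapAnswers f).step x as =
M.step x (as.map f)`, so that an oracle may append bookkeeping to its answers without `M`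
noticing — the device by which the GGM simulator's oracle echoes each query after the answer
(`Cryptography/GGMSimulator.lean`: `f = fstF`, the answer is the first component of a pair), in
the way Bennett–Gill's simulator echoes queries after one-bit answers (`LazySamplingMachine.lean`
with `trimAnswers`).

* `OracleAlg.mapAnswers`, `mapAnswers_step`;
* **`OracleAlg.isPolyTime_mapAnswers`** — `(M.mapAnswers f)` is polynomial-time when `M` is, for
  `f ∈ FP` with `|f a| ≤ |a|`. No machine is written: the coded transcript
  `listBool as = ⟨1^{|as|}, encList as⟩` (`listBool_encode_eq_encList`, `ListFoldChecks.lean`) is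
  re-coded to `listBool (as.map f)` by the tree's snoc-map brick over coded lists
  `DinurSafraFP.mapAppFn` (the "generic bricks" section of `CSPToCMMSAReductionProofs.lean`: a
  `Brick.foldFn` accumulating the `encList` of the images by concatenation — imported from there
  rather than restated; refactor: hoist it next to `ListFoldBricks.lean`), applied to the second
  component of the step input (`mapSndFn`, `StringSwap.lean`) and composed with the step machine
  (`PolyTimeComputable.of_encode`, `comp_holds`).

## References

* S. Arora, B. Barak, *Computational Complexity: A Modern Approach*, CUP 2009, §3.4 (oracle
  machines), §1.3 (closure of polynomial time under composition and bounded loops).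
-/

namespace Literature.Computability.Complexity

open _root_.Computability PrePost Brick DinurSafraFP

namespace OracleAlg

variable {β : Type}

/-- **Reading the answers through `f`**: `(M.mapAnswers f).step x as = M.step x (as.map f)`.
[Arora–Barak 2009, §3.4] [folklore] -/
def mapAnswers (M : OracleAlg β) (f : List Bool → List Bool) : OracleAlg β where
  step x as := M.step x (as.map f)

/-- The step of `M.mapAnswers f` (definitional). [folklore] -/
@[simp] theorem mapAnswers_step (M : OracleAlg β) (f : List Bool → List Bool) (x : List Bool)
    (as : List (List Bool)) : (M.mapAnswers f).step x as = M.step x (as.map f) :=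
  rfl

namespace MapAnswersPoly

/-- **The re-coder** of a coded transcript: `⟨hdr, L⟩ ↦ ⟨hdr, encList ((items of L).map f)⟩`,
the snoc-map brick `mapAppFn` with the item function `f ∘ sndF` (the item `a` arrives as
`⟨hdr, a⟩`). [Arora–Barak 2009, §1.3 (bounded loops)] [folklore] -/
noncomputable def recode (f : List Bool → List Bool) : List Bool → List Bool :=
  fanoutFn fstF (mapAppFn (f ∘ sndF))

/-- Value of the re-coder on a pair. [folklore] -/
theorem recode_apply (f : List Bool → List Bool) (hdr L : List Bool) :
    recode f (boolPair hdr L) = boolPair hdr (encList ((decNil L).map f)) := by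
  rw [recode, fanoutFn_apply, fstF_boolPair, mapAppFn_boolPair]
  simp only [Function.comp_apply, sndF_boolPair]

/-- **The re-coder maps the coded transcript**: `listBool as ↦ listBool (as.map f)`. [folklore] -/
theorem recode_listBool (f : List Bool → List Bool) (as : List (List Bool)) :
    recode f ((encodingList Bool).listBool.encode as) = (encodingList Bool).listBool.encode (as.map f) := by
  have hid : ∀ l : List (List Bool), l.map (encodingList Bool).encode = l := fun l => List.map_id l
  rw [listBool_encode_eq_encList, hid, recode_apply, decNil_encList, listBool_encode_eq_encList, hid,
    List.length_map]

/-- `recode f ∈ FP` for a non-lengthening `f ∈ FP`. [folklore] -/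
theorem recode_mem_FP {f : List Bool → List Bool} (hf : f ∈ FP) (hlen : ∀ a, (f a).length ≤ a.length) :
    recode f ∈ FP :=
  fanoutFn_mem_FP fstF_mem_FP (mapAppFn_mem_FP (comp_mem_FP hf sndF_mem_FP) (C := 0) fun z => by
    have h := hlen (sndF z)
    simp only [Function.comp_apply]
    omega)

end MapAnswersPoly

open MapAnswersPoly

/-- **`M.mapAnswers f` is polynomial-time** for `M` polynomial-time and a non-lengthening
`f ∈ FP`: the step input `⟨x, listBool as⟩ ↦ ⟨x, listBool (as.map f)⟩` is `mapSndFn (recode f)`.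
[Arora–Barak 2009, §3.4 with §1.3] [folklore] -/
theorem isPolyTime_mapAnswers {eb : Encoding β Bool} {M : OracleAlg β} (hM : M.IsPolyTime eb)
    {f : List Bool → List Bool} (hf : f ∈ FP) (hlen : ∀ a, (f a).length ≤ a.length) :
    (M.mapAnswers f).IsPolyTime eb := by
  have hin : PolyTimeComputable encIn encIn (fun p : List Bool × List (List Bool) => (p.1, p.2.map f)) := by
    refine PolyTimeComputable.of_encode (mapSndFn_mem_FP (recode_mem_FP hf hlen)) encIn (fun _ => rfl) fun p => ?_
    obtain ⟨w, as⟩ := p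
    show mapSndFn (recode f) (boolPair w _) = boolPair w _
    rw [mapSndFn_boolPair, recode_listBool]
  have h := PolyTimeComputable.comp_holds hM hin
  exact h

end OracleAlg

end Literature.Computability.Complexity
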